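import Summits.Ventures.HodgeRepro2.T5SU11SoninPolyaGroup
import Summits.Ventures.HodgeRepro2.T5SU11SphericalLegendreHigher

/-!
# The Liouville form of the radial equation: `w_λ = √(sinh 2t) φ_λ(a_t)` satisfies `w″ = ((λ−1)² − 1/sinh² 2t) w`

The substitution `w = √p · u`, `p = sinh 2t`, removes the first-order term of the radial equation
`(sinh 2t · u′)′ = λ(λ−2) sinh 2t · u`: with `p′ = 2 cosh 2t`, `p″ = 4 sinh 2t` and `cosh² − sinh² = 1`,

  **`w_λ″ = ((λ−1)² − 1/sinh² 2t) · w_λ`** on `(0, ∞)` (`hasDerivAt_liouW'`; `w_λ′ = cosh 2t/√(sinh 2t) · φ_λ +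
  √(sinh 2t) φ_λ′`, `hasDerivAt_liouW`).

Consequences: at the bottom of the spectrum `λ = 1` the function `√(sinh 2t) Ξ(a_t)` is **concave** on `(0, ∞)`
(`liouW_one_concave`: `w″ = −w/sinh² 2t < 0`, `concaveOn_of_deriv2_nonpos`), positive (`liouW_pos`); and the
Sonin–Pólya corollaries of row 486: **the successive extremal values of `φ_λ` decrease in absolute value** on the
oscillatory window (`sq_le_sq_of_critical`: `φ_λ′(a_s) = 0`, `0 ≤ s ≤ t` ⟹ `φ_λ(a_t)² ≤ φ_λ(a_s)²`), and the odd
symmetry `φ_λ′(a_{−t}) = −φ_λ′(a_t)` (`deriv_sph_hyp_neg`), which transports rows 486's bounds to `t < 0`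
(`deriv_sq_le'`).

Nothing is claimed about (N).

Blind lane: Mathlib + the HodgeRepro2 prefix only; no sorry; axioms ⊆ {propext, Classical.choice,
Quot.sound}.
-/

namespace Summit.Ventures.HodgeRepro2.T5SU11LiouvilleForm

open Set (Ici Ioi Icc)
open T5SU11Cartan T5SU11SphericalFunction T5SU11SphericalBounds T5SU11SphericalDeriv T5SU11SphericalODE
  T5SU11SphericalSolutionSpaceAll T5SU11SphericalLegendreHigher T5SU11ReductionOfOrder T5SU11SoninPolyaGroup

section measure

variable [MeasurableSpace Circle] [BorelSpace Circle]

/-- **The Liouville transform** `w_λ(t) = √(sinh 2t) · φ_λ(a_t)`. -/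
noncomputable def liouW (lam t : ℝ) : ℝ := Real.sqrt (Real.sinh (2 * t)) * sph lam (hyp t)

/-- `w_λ′ = cosh 2t/√(sinh 2t) · φ_λ(a_t) + √(sinh 2t) · φ_λ′(a_t)`. -/
noncomputable def liouW' (lam t : ℝ) : ℝ :=
  Real.cosh (2 * t) / Real.sqrt (Real.sinh (2 * t)) * sph lam (hyp t)
    + Real.sqrt (Real.sinh (2 * t)) * deriv (fun t => sph lam (hyp t)) t

omit [MeasurableSpace Circle] [BorelSpace Circle] in
/-- `(√(sinh 2t))′ = cosh 2t/√(sinh 2t)` for `t > 0`. -/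
theorem hasDerivAt_sqrt_sinh {t : ℝ} (ht : 0 < t) :
    HasDerivAt (fun t => Real.sqrt (Real.sinh (2 * t))) (Real.cosh (2 * t) / Real.sqrt (Real.sinh (2 * t))) t := by
  have hs : Real.sinh (2 * t) ≠ 0 := (sinh_two_mul_pos ht).ne'
  have h := (hasDerivAt_sinh_two_mul_self t).sqrt hs
  refine h.congr_deriv ?_
  exact mul_div_mul_left _ _ two_ne_zero

/-- `w_λ` has derivative `w_λ′` on `(0, ∞)`. -/
theorem hasDerivAt_liouW (lam : ℝ) {t : ℝ} (ht : 0 < t) : HasDerivAt (liouW lam) (liouW' lam t) t := by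
  have h := (hasDerivAt_sqrt_sinh ht).mul (hasDerivAt_sph_hyp_deriv lam t)
  unfold liouW liouW'
  exact h

/-- **THE LIOUVILLE FORM**: `w_λ″ = ((λ−1)² − 1/sinh² 2t) · w_λ` on `(0, ∞)`. -/
theorem hasDerivAt_liouW' (lam : ℝ) {t : ℝ} (ht : 0 < t) :
    HasDerivAt (liouW' lam) (((lam - 1) ^ 2 - 1 / Real.sinh (2 * t) ^ 2) * liouW lam t) t := by
  have hspos := sinh_two_mul_pos ht
  have hs : Real.sinh (2 * t) ≠ 0 := hspos.ne'
  have hr : Real.sqrt (Real.sinh (2 * t)) ≠ 0 := (Real.sqrt_pos.mpr hspos).ne'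
  have h1 := ((hasDerivAt_cosh_two_mul_self t).div (hasDerivAt_sqrt_sinh ht) hr).mul
    (hasDerivAt_sph_hyp_deriv lam t)
  have h2 := (hasDerivAt_sqrt_sinh ht).mul (hasDerivAt_deriv_sph_hyp lam t)
  have h := h1.add h2
  unfold liouW' liouW
  refine h.congr_deriv ?_
  simp only [Pi.div_apply]
  have e := sph_hyp_ode_deriv lam t
  have hc : Real.cosh (2 * t) ^ 2 = Real.sinh (2 * t) ^ 2 + 1 := Real.cosh_sq (2 * t)
  have hq : deriv (deriv fun t => sph lam (hyp t)) t
      = (lam * (lam - 2) * Real.sinh (2 * t) * sph lam (hyp t)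
          - 2 * Real.cosh (2 * t) * deriv (fun t => sph lam (hyp t)) t) / Real.sinh (2 * t) := by
    rw [eq_div_iff hs]
    linear_combination e
  rw [hq]
  set r := Real.sqrt (Real.sinh (2 * t)) with hr_def
  have hr2 : r ^ 2 = Real.sinh (2 * t) := Real.sq_sqrt hspos.le
  rw [← hr2] at hc ⊢
  field_simp
  linear_combination (-(sph lam (hyp t))) * hc

/-- `w_λ > 0` on `(0, ∞)`. -/
theorem liouW_pos (lam : ℝ) {t : ℝ} (ht : 0 < t) : 0 < liouW lam t :=
  mul_pos (Real.sqrt_pos.mpr (sinh_two_mul_pos ht)) (sph_hyp_pos lam t)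

/-- `w_λ` is differentiable on `(0, ∞)`. -/
theorem differentiableOn_liouW (lam : ℝ) : DifferentiableOn ℝ (liouW lam) (Ioi 0) :=
  fun _ ht => (hasDerivAt_liouW lam ht).differentiableAt.differentiableWithinAt

/-- `deriv w_λ = w_λ′` on `(0, ∞)`. -/
theorem deriv_liouW (lam : ℝ) {t : ℝ} (ht : 0 < t) : deriv (liouW lam) t = liouW' lam t :=
  (hasDerivAt_liouW lam ht).deriv

/-- **`√(sinh 2t) Ξ(a_t)` is concave on `(0, ∞)`** (`w_1″ = −w_1/sinh² 2t < 0`). -/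
theorem liouW_one_concaveOn : ConcaveOn ℝ (Ioi 0) (liouW 1) := by
  refine concaveOn_of_deriv2_nonpos (convex_Ioi 0) (differentiableOn_liouW 1).continuousOn ?_ ?_ ?_
  · rw [interior_Ioi]
    exact differentiableOn_liouW 1
  · rw [interior_Ioi]
    intro t ht
    have ht0 : 0 < t := ht
    have hev : deriv (liouW 1) =ᶠ[nhds t] liouW' 1 :=
      Filter.eventuallyEq_of_mem (Ioi_mem_nhds ht0) (fun _ hs => deriv_liouW 1 hs)
    exact ((hasDerivAt_liouW' 1 ht0).congr_of_eventuallyEq hev).differentiableAt.differentiableWithinAt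
  · rw [interior_Ioi]
    intro t ht
    have ht0 : 0 < t := ht
    have hev : deriv (liouW 1) =ᶠ[nhds t] liouW' 1 :=
      Filter.eventuallyEq_of_mem (Ioi_mem_nhds ht0) (fun _ hs => deriv_liouW 1 hs)
    show deriv (deriv (liouW 1)) t ≤ 0
    rw [((hasDerivAt_liouW' 1 ht0).congr_of_eventuallyEq hev).deriv]
    have hw := liouW_pos 1 ht0
    have hs : 0 < Real.sinh (2 * t) ^ 2 := pow_pos (sinh_two_mul_pos ht0) 2
    have : (1 - 1) ^ 2 - 1 / Real.sinh (2 * t) ^ 2 < 0 := by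
      rw [sub_self, zero_pow two_ne_zero, zero_sub, neg_lt_zero]
      positivity
    exact (mul_neg_of_neg_of_pos this hw).le

/-! ### Sonin–Pólya corollaries (row 486) -/

/-- **The successive extremal values of `φ_λ` decrease**: for `0 < λ < 2`, `0 ≤ s ≤ t` and `φ_λ′(a_s) = 0`,
`φ_λ(a_t)² ≤ φ_λ(a_s)²`. -/
theorem sq_le_sq_of_critical {lam : ℝ} (h0 : 0 < lam) (h2 : lam < 2) {s t : ℝ} (hs : 0 ≤ s) (hst : s ≤ t)
    (hcrit : deriv (fun t => sph lam (hyp t)) s = 0) : sph lam (hyp t) ^ 2 ≤ sph lam (hyp s) ^ 2 := by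
  have hμ : lam * (lam - 2) < 0 := mul_neg_of_pos_of_neg h0 (by linarith)
  have h := energy_antitoneOn h0 h2 (Set.mem_Ici.mpr hs) (Set.mem_Ici.mpr (le_trans hs hst)) hst
  simp only at h
  rw [hcrit, zero_pow two_ne_zero, zero_div, sub_zero] at h
  have : 0 ≤ -((deriv (fun t => sph lam (hyp t)) t) ^ 2 / (lam * (lam - 2))) := by
    rw [neg_nonneg]
    exact div_nonpos_of_nonneg_of_nonpos (sq_nonneg _) hμ.le
  linarith

/-- **`φ_λ′` is odd**: `φ_λ′(a_{−t}) = −φ_λ′(a_t)` (from `φ_λ(a_{−t}) = φ_λ(a_t)`). -/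
theorem deriv_sph_hyp_neg (lam t : ℝ) :
    deriv (fun t => sph lam (hyp t)) (-t) = -deriv (fun t => sph lam (hyp t)) t := by
  have h := (hasDerivAt_sph_hyp_deriv lam (-t)).comp t (hasDerivAt_neg t)
  have e : (fun t => sph lam (hyp t)) ∘ Neg.neg = fun t => sph lam (hyp t) := by
    funext s
    simp only [Function.comp_apply]
    exact sph_hyp_neg lam s
  rw [e] at h
  have := h.unique (hasDerivAt_sph_hyp_deriv lam t)
  linarith

/-- **The Bernstein-type bound for every `t`** (row 486 transported to `t < 0`): `φ_λ′(a_t)² ≤ λ(2−λ)(1 − φ_λ(a_t)²)`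
for `0 < λ < 2`. -/
theorem deriv_sq_le' {lam : ℝ} (h0 : 0 < lam) (h2 : lam < 2) (t : ℝ) :
    (deriv (fun t => sph lam (hyp t)) t) ^ 2 ≤ lam * (2 - lam) * (1 - sph lam (hyp t) ^ 2) := by
  rcases le_or_gt 0 t with ht | ht
  · exact deriv_sq_le h0 h2 ht
  · have h := deriv_sq_le h0 h2 (t := -t) (by linarith)
    rwa [deriv_sph_hyp_neg, neg_sq, sph_hyp_neg] at h

end measure

end Summit.Ventures.HodgeRepro2.T5SU11LiouvilleForm
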